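import Summits.QuantumFields.BalabanUV.T4Continuum.Support.ShellMeasureLandauWilsonSquaresPinned

/-!
# `T4Continuum.ShellMeasureLandauWilsonSquaresTwisted` — row S83 (owner audit γ5, WALL §2b row `c V`): S74 ON THE CURVED
# BACKGROUND AS PRINTED — the INTERLEAVED plaquette word (moving letters between frozen background bond variables) IS S74's
# one-prefactor form with TWISTED read-outs; END-II's `hE` for the interleaved Wilson profile (flat + pinned); the curl
# read-out becomes the COVARIANT curl
(cell `pub-balaban`, sub-cell `t4`, spine estimate NE7c (node U5b); NE7c ROUND-2 crew, unit `b2b-balaban-t4-ne7c-formalise-leaf-08`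
gen 14; owner table `t4/b2b-balaban-t4-ne7c-p1/LEAVES-NE7c-P1.md` row S83 (my OFFER journal l.17718, owner g32 GO + «γ5 DELEGATED»
l.17772 with the acceptance test quoted at `interleaved_eq_left`); ADDITIVE — imports S74 f2 `ShellMeasureLandauWilsonSquaresPinned`
(leaf-09-g11, p226365∕p226646; hence f1 p225819) ONLY; [folklore]; ONE DATA `def` (`twistRO`), 0 `def … : Prop`, 0 sorry, 0 cite)

HONEST FRAMING.  Finite four-torus programme, rung (B)+1 only — NOT infinite volume, NOT a mass gap, NOT the Clay problem,
NOT summit progress; (B), `BetaPertHyp`, (B^μ) not consumed.  NE7c (`T4IndicatorShell.ShellWeightBound`) is NOT PRINTED in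
[Balaban 1983–89] and NOT PROVED; «NE7c ⇐ the named binders» (trigger c3).  Nothing printed is asserted: B11
([Balaban1985Variational]) (18) «U = U′U₀», (22) «U¹ = e^{iηA}», (25) (the plaquette variable of the composed configuration in
the ROTATED letters `R(U₀(·))A(b)`, «the expression in parenthesis (…) is equal to η(DA)(p)») and (34) (the same word,
BCH-free) are LOCATORS for the SHAPE handled here; no estimate of Bałaban's is discharged; ALGEBRA + WIRING on OUR side (one
conjugation per letter, cyclicity of the trace, ONE call of S74 per twin).  HONEST DEPENDENCY (cell): continuum YM on T⁴ ⇐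
BetaPertH ∧ nine spine estimates (0/9 proved); BetaPertH ⇐ (D1) ∧ (D4) ∧ CAP+tail; G-an2-4 gates asym, D1 and NE2/3/4.

THE POINT.  S74 (`hE_of_wilsonPlaquettes`, `hE_landau_wilsonSquares`, f2 `hE_landau_wilsonSquares_pinned`) reads the Wilson
plaquette on the curved background as `B_p · e^{X₁}⋯e^{X_m}` — ONE frozen unitary prefactor LEFT of the word of moving letters
(owner N-ne7cp1-g31-2 (W1′)).  The plaquette variable of a configuration `b ↦ e^{X(b)}·U₀(b)` (reversed bonds contributing
`U₀(b)⁻¹e^{−X(b)}`) is the INTERLEAVED word `u₁e^{x₁}·u₂e^{x₂}⋯u_me^{x_m}·u_T` (adjacent frozen factors merged per position, `1`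
where none).  By `u·e^{x} = e^{uxu⋆}·u` (§1) it EQUALS `e^{y₁}⋯e^{y_m}·B` with `B = u₁⋯u_m u_T` (the background PLAQUETTE
`U₀(∂p)`) and TWISTED letters `y_k = (u₁⋯u_k)·x_k·(u₁⋯u_k)⋆` (§2 `mul_interleaved_eq`), `= B·e^{B⋆y₁B}⋯e^{B⋆y_mB}`
(`interleaved_eq_left`), and by cyclicity `tr = tr(B·e^{y₁}⋯e^{y_m})` (`trace_interleaved_eq`) — S74's form.  Twisting by
unitaries PRESERVES every per-letter datum S74 displays (op-norm bounds flat or pinned, C⋆ norm; skew-adjointness on real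
points; length) EXCEPT the letter SUM, which becomes the prefix-conjugated («covariant») sum `Σ_k (u₁⋯u_k)(ℓ_k Y)(u₁⋯u_k)⋆` =
print's `η(D_{U₀}A)(p)` of (25) (`twistRO_sum_four`).
* §1∕§2 (`M_N(ℂ)`, C⋆ norm): `exp_unitary_conj`, `unitary_mul_exp`; `twistRO` (DATA: the twisted
  read-outs along a list of (frozen factor, read-out) pairs — the READ-OUT-level twin of leaf-03's `ShellMeasurePlaquetteTwist.twists`,
  which lives in S62's bond-field currency and is neither imported nor restated), `twistRO_length`, **`mul_interleaved_eq`** ∕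
  `interleaved_eq` ∕ `conj_wordExp` ∕ **`interleaved_eq_left`** ∕ **`trace_interleaved_eq`**, **`norm_twistRO_le`** (per-letter
  bounds PRESERVED, any bound shape `g`), **`twistRO_skew`** (skewness PRESERVED), `twistRO_sum_four`.
* §3 **`hE_landau_wilsonSquares_twisted`** (flat, S74 §4) and **`hE_landau_wilsonSquares_pinned_twisted`** (pinned, S74 f2 §3 —
  the live-level form) RE-CONCLUDED for the INTERLEAVED Wilson ray profile
  `𝓔_W y := Σ_{p∈P_w} β·(1 − Re tr((Π_k u_{p,k}·exp(ℓ_{p,k}(Z y)))·u_{T,p})∕N)` on the LD chain (`Z` VERBATIM as in S74): binders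
  = S74's VERBATIM (chain ∕ pinned chain; per-letter bounds `κ_w p` on the UNtwisted read-outs; `hskew`; lengths; the same
  second-order budgets) except (i) `hu`∕`huT` (frozen factors unitary), `hBd` on the background plaquette `‖B_p − 1‖ ≤ d_p`
  ((14)∕(19)∕(2.17) TYPE, DISPLAYED) and (ii) `hcurl`∕`hcurlπ` on the TWISTED list — the covariant-curl read-out norm `κ_c p`
  (B11 (25)∕(37) TYPE; `κ_c ∝ η²` is the located reading of F-ne7cp1-g31-1 (A), NOT asserted).  Conclusions LITERALLY END-II's
  `hE` with `B_𝓔 = 3H̄∕(r_Φ∕S − 1)`: S74 §5 `hE_add`, S76 f2's `hEW` slot and S80 take the interleaved profile unchanged.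
WHAT IT CHANGES: the `c V` row's parenthetical is KERNEL on OUR side — the one-prefactor form is not an approximation of the
interleaved plaquette but EQUAL to it after twisting, letter sizes unchanged; the only currency change is flat curl → covariant
curl in `hcurl`.  NOT HERE: any η-display beyond S74's; nothing of Bałaban's discharged.  NE7c NOT PROVED; spine PROVED 0∕9.
-/


noncomputable section

open Set Metric NormedSpace
open scoped Matrix

namespace Summit.QuantumFields.BalabanUV.T4Continuum.ShellMeasureLandauWilsonSquaresTwisted

open Literature.MathematicalPhysics.QuantumFieldTheory.Balaban1983to89
open B11Prop6Scheme (Prop4Hyp)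
open T4ShellMeasurePlaquette (expTail₂)
open Summit.QuantumFields.BalabanUV.T4Continuum.ShellMeasureWilsonWords (wordExp wordExp_nil wordExp_cons)
open Summit.QuantumFields.BalabanUV.T4Continuum.ShellMeasureLandauHolonomy (solAt landauExp)
open Summit.QuantumFields.BalabanUV.T4Continuum.ShellMeasureLandauHolonomyChart (holOf holOf_apply cplx)
open Summit.QuantumFields.BalabanUV.T4Continuum.ShellMeasureLandauWilsonSquares (hE_landau_wilsonSquares)
open Summit.QuantumFields.BalabanUV.T4Continuum.ShellMeasureLandauWilsonSquaresPinned (hE_landau_wilsonSquares_pinned)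

/-! ## §1 Conjugation by a unitary in `M_N(ℂ)` commutes with `exp` (the isometry `‖uXu⋆‖ = ‖X‖` is the tree's
`NE3SupControl.norm_conj_unitary_eq` — two Mathlib rewrites, inlined in §2) -/

section Twist

open scoped Matrix.Norms.L2Operator

variable {n : Type*} [Fintype n] [DecidableEq n]
variable {𝒴 : Type*} [NormedAddCommGroup 𝒴] [NormedSpace ℂ 𝒴]

/-- `exp(uXu⋆) = u·exp X·u⋆` for unitary `u` (Mathlib `NormedSpace.exp_units_conj` at the unit `⟨u, u⋆⟩`). [folklore] -/
theorem exp_unitary_conj {u : Matrix n n ℂ} (hu : u ∈ unitary (Matrix n n ℂ)) (X : Matrix n n ℂ) :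
    exp (u * X * star u) = u * exp X * star u := by
  letI : NormedAlgebra ℚ (Matrix n n ℂ) := NormedAlgebra.restrictScalars ℚ ℂ (Matrix n n ℂ)
  exact exp_units_conj ⟨u, star u, Unitary.mul_star_self_of_mem hu, Unitary.star_mul_self_of_mem hu⟩ X

/-- ONE LETTER PASSES ONE FROZEN FACTOR: `u·e^{X} = e^{uXu⋆}·u` for unitary `u` ([Balaban1985Variational] (25)∕(34): the rotated
letters `R(U₀(·))A(b)` — LOCATOR for the shape). [folklore] -/
theorem unitary_mul_exp {u : Matrix n n ℂ} (hu : u ∈ unitary (Matrix n n ℂ)) (X : Matrix n n ℂ) :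
    u * exp X = exp (u * X * star u) * u := by
  rw [exp_unitary_conj hu, mul_assoc, Unitary.star_mul_self_of_mem hu, mul_one]

/-! ## §2 The twisted read-outs and the twisting identity -/

/-- **THE TWISTED READ-OUTS** (DATA).  Along a list of pairs `(u_k, ℓ_k)` — a FROZEN factor `u_k` (the background bond
variable(s) before the `k`-th moving letter, orientation applied, adjacent ones merged) and a READ-OUT `ℓ_k : 𝒴 →L[ℂ] M_N(ℂ)` —
and a prefix `P`, the `k`-th twisted read-out is `Y ↦ (Pu₁⋯u_k)·(ℓ_k Y)·(Pu₁⋯u_k)⋆` ([Balaban1985Variational] (25)∕(34): the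
rotated letters `A′(b)` — LOCATOR; the read-out-level twin of `ShellMeasurePlaquetteTwist.twists`). [folklore] -/
def twistRO : Matrix n n ℂ → List (Matrix n n ℂ × (𝒴 →L[ℂ] Matrix n n ℂ)) → List (𝒴 →L[ℂ] Matrix n n ℂ)
  | _, [] => []
  | P, q :: rest =>
    (ContinuousLinearMap.mulLeftRight ℂ (Matrix n n ℂ) (P * q.1) (star (P * q.1))).comp q.2 :: twistRO (P * q.1) rest

/-- [folklore] -/
@[simp] theorem twistRO_nil (P : Matrix n n ℂ) : twistRO P ([] : List (Matrix n n ℂ × (𝒴 →L[ℂ] Matrix n n ℂ))) = [] := rfl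

/-- [folklore] -/
@[simp] theorem twistRO_cons (P : Matrix n n ℂ) (q : Matrix n n ℂ × (𝒴 →L[ℂ] Matrix n n ℂ)) (rest) : twistRO P (q :: rest) =
    (ContinuousLinearMap.mulLeftRight ℂ (Matrix n n ℂ) (P * q.1) (star (P * q.1))).comp q.2 :: twistRO (P * q.1) rest := rfl

/-- a twisted read-out unfolded: `Y ↦ v(ℓ Y)v⋆`. [folklore] -/
theorem twist_apply (v : Matrix n n ℂ) (ℓ : 𝒴 →L[ℂ] Matrix n n ℂ) (Y : 𝒴) :
    ((ContinuousLinearMap.mulLeftRight ℂ (Matrix n n ℂ) v (star v)).comp ℓ) Y = v * ℓ Y * star v := by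
  simp [ContinuousLinearMap.mulLeftRight_apply]

/-- twisting preserves the WORD LENGTH. [folklore] -/
theorem twistRO_length : ∀ (P : Matrix n n ℂ) (qs : List (Matrix n n ℂ × (𝒴 →L[ℂ] Matrix n n ℂ))),
    (twistRO P qs).length = qs.length
  | _, [] => rfl | P, q :: rest => by rw [twistRO_cons, List.length_cons, List.length_cons, twistRO_length]

/-- **THE TWISTING IDENTITY** ([Balaban1985Variational] (25)∕(34) BCH-free, at the read-out level): for a unitary prefix `P`
and unitary frozen factors, `P · Π_k (u_k·exp(ℓ_k Y)) = wordExp((twistRO P qs).map (· Y)) · (P · Π_k u_k)` (induction on the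
list, one `u·e^{X} = e^{uXu⋆}·u` per letter). [folklore] -/
theorem mul_interleaved_eq : ∀ (qs : List (Matrix n n ℂ × (𝒴 →L[ℂ] Matrix n n ℂ))) {P : Matrix n n ℂ},
    P ∈ unitary (Matrix n n ℂ) → (∀ q ∈ qs, q.1 ∈ unitary (Matrix n n ℂ)) → ∀ Y : 𝒴,
    P * (qs.map fun q => q.1 * exp (q.2 Y)).prod =
      wordExp ((twistRO P qs).map fun ℓ => ℓ Y) * (P * (qs.map Prod.fst).prod)
  | [], P, _, _, Y => by simp
  | q :: rest, P, hP, hq, Y => by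
    have hPu : P * q.1 ∈ unitary (Matrix n n ℂ) := (unitary _).mul_mem hP (hq q (by simp))
    have ih := mul_interleaved_eq rest hPu (fun q' hq' => hq q' (List.mem_cons_of_mem _ hq')) Y
    rw [List.map_cons, List.prod_cons, twistRO_cons, List.map_cons, wordExp_cons, List.map_cons, List.prod_cons,
      twist_apply]
    calc P * (q.1 * exp (q.2 Y) * (rest.map fun q => q.1 * exp (q.2 Y)).prod)
        = (P * q.1) * exp (q.2 Y) * (rest.map fun q => q.1 * exp (q.2 Y)).prod := by simp only [mul_assoc]
      _ = exp (P * q.1 * q.2 Y * star (P * q.1)) * ((P * q.1) * (rest.map fun q => q.1 * exp (q.2 Y)).prod) := by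
          rw [unitary_mul_exp hPu, mul_assoc]
      _ = exp (P * q.1 * q.2 Y * star (P * q.1)) * wordExp ((twistRO (P * q.1) rest).map fun ℓ => ℓ Y) *
            (P * (q.1 * (rest.map Prod.fst).prod)) := by rw [ih]; simp only [mul_assoc]

/-- The case `P = 1`, with a TRAILING frozen factor `uT`: `(Π_k u_k·exp(ℓ_k Y))·uT = wordExp(twisted letters)·((Π_k u_k)·uT)` —
the frozen word `(Π_k u_k)·uT` is the background PLAQUETTE. [folklore] -/
theorem interleaved_eq (qs : List (Matrix n n ℂ × (𝒴 →L[ℂ] Matrix n n ℂ)))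
    (hq : ∀ q ∈ qs, q.1 ∈ unitary (Matrix n n ℂ)) (uT : Matrix n n ℂ) (Y : 𝒴) :
    (qs.map fun q => q.1 * exp (q.2 Y)).prod * uT =
      wordExp ((twistRO 1 qs).map fun ℓ => ℓ Y) * ((qs.map Prod.fst).prod * uT) := by
  have h := mul_interleaved_eq qs (P := 1) (unitary _).one_mem hq Y
  rw [one_mul, one_mul] at h
  rw [h, mul_assoc]

/-- `W·B = B·(B⋆WB)` for unitary `B`. [folklore] -/
theorem mul_eq_mul_conj {B : Matrix n n ℂ} (hB : B ∈ unitary (Matrix n n ℂ)) (W : Matrix n n ℂ) :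
    W * B = B * (star B * W * B) := by
  rw [← mul_assoc, ← mul_assoc, Unitary.mul_star_self_of_mem hB, one_mul]

/-- conjugating a word of exponentials by a unitary conjugates its letters. [folklore] -/
theorem conj_wordExp : ∀ (l : List (Matrix n n ℂ)) {v : Matrix n n ℂ}, v ∈ unitary (Matrix n n ℂ) →
    v * wordExp l * star v = wordExp (l.map fun y => v * y * star v)
  | [], v, hv => by simp [Unitary.mul_star_self_of_mem hv]
  | y :: l, v, hv => by
    rw [List.map_cons, wordExp_cons, wordExp_cons, ← conj_wordExp l hv, exp_unitary_conj hv]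
    simp only [mul_assoc]
    rw [← mul_assoc (star v) v, Unitary.star_mul_self_of_mem hv, one_mul]

/-- **THE LEFT-PREFACTOR FORM** (the owner's acceptance test for row S83, journal l.17772: «`∏_b U₀(b)·e^{X_b}` = S74's
one-prefactor form `B_p·∏_b e^{Ad X_b}` with `B_p = hol_p(U₀)` unitary»): with `B := (Π_k u_k)·uT`,
`(Π_k u_k·exp(ℓ_k Y))·uT = B · wordExp(letters B⋆·y_k·B)`, `y_k` the twisted letters — one more unitary conjugation of
`interleaved_eq` (norms and skewness again preserved). [folklore] -/
theorem interleaved_eq_left (qs : List (Matrix n n ℂ × (𝒴 →L[ℂ] Matrix n n ℂ)))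
    (hq : ∀ q ∈ qs, q.1 ∈ unitary (Matrix n n ℂ)) {uT : Matrix n n ℂ} (huT : uT ∈ unitary (Matrix n n ℂ)) (Y : 𝒴) :
    (qs.map fun q => q.1 * exp (q.2 Y)).prod * uT =
      ((qs.map Prod.fst).prod * uT) * wordExp (((twistRO 1 qs).map fun ℓ => ℓ Y).map fun y =>
        star ((qs.map Prod.fst).prod * uT) * y * ((qs.map Prod.fst).prod * uT)) := by
  have hB : (qs.map Prod.fst).prod * uT ∈ unitary (Matrix n n ℂ) :=
    (unitary _).mul_mem (list_prod_mem fun u hu' => by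
      obtain ⟨q, hq', rfl⟩ := List.mem_map.1 hu'; exact hq q hq') huT
  have h := conj_wordExp ((twistRO 1 qs).map fun ℓ => ℓ Y) (Unitary.star_mem hB)
  rw [star_star] at h
  rw [interleaved_eq qs hq uT Y, ← h]
  exact mul_eq_mul_conj hB _

/-- **THE TRACE FORM S74 CONSUMES** (cyclicity): `tr((Π_k u_k·exp(ℓ_k Y))·uT) = tr(B · wordExp(twisted letters))` with
`B := (Π_k u_k)·uT`. [folklore] -/
theorem trace_interleaved_eq (qs : List (Matrix n n ℂ × (𝒴 →L[ℂ] Matrix n n ℂ)))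
    (hq : ∀ q ∈ qs, q.1 ∈ unitary (Matrix n n ℂ)) (uT : Matrix n n ℂ) (Y : 𝒴) :
    Matrix.trace ((qs.map fun q => q.1 * exp (q.2 Y)).prod * uT) =
      Matrix.trace (((qs.map Prod.fst).prod * uT) * wordExp ((twistRO 1 qs).map fun ℓ => ℓ Y)) := by
  rw [interleaved_eq qs hq uT Y, Matrix.trace_mul_comm]

/-- **PER-LETTER NORM BOUNDS ARE PRESERVED**: if every read-out satisfies `‖ℓ_k Y‖ ≤ g Y` (flat `g Y = κ‖Y‖`, or pinned
`g Y = κ‖π𝒴 Y‖`), so does every twisted read-out along unitary frozen factors from a unitary prefix (`‖uXu⋆‖ = ‖X‖`).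
[folklore] -/
theorem norm_twistRO_le : ∀ (qs : List (Matrix n n ℂ × (𝒴 →L[ℂ] Matrix n n ℂ))) {P : Matrix n n ℂ},
    P ∈ unitary (Matrix n n ℂ) → (∀ q ∈ qs, q.1 ∈ unitary (Matrix n n ℂ)) → ∀ {g : 𝒴 → ℝ},
    (∀ q ∈ qs, ∀ Y : 𝒴, ‖q.2 Y‖ ≤ g Y) → ∀ ℓ ∈ twistRO P qs, ∀ Y : 𝒴, ‖ℓ Y‖ ≤ g Y
  | [], _, _, _, _, _, ℓ, hℓ, _ => by simp at hℓ
  | q :: rest, P, hP, hq, g, hg, ℓ, hℓ, Y => by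
    have hPu : P * q.1 ∈ unitary (Matrix n n ℂ) := (unitary _).mul_mem hP (hq q (by simp))
    rw [twistRO_cons, List.mem_cons] at hℓ
    rcases hℓ with rfl | hℓ
    · -- `‖vXv⋆‖ = ‖X‖` (C⋆ norm; the tree's `NE3SupControl.norm_conj_unitary_eq`, two Mathlib rewrites)
      rw [twist_apply, CStarRing.norm_mul_mem_unitary _ (Unitary.star_mem hPu), CStarRing.norm_mem_unitary_mul _ hPu]
      exact hg q (by simp) Y
    · exact norm_twistRO_le rest hPu (fun q' hq' => hq q' (List.mem_cons_of_mem _ hq'))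
        (fun q' hq' => hg q' (List.mem_cons_of_mem _ hq')) ℓ hℓ Y

/-- **SKEWNESS IS PRESERVED**: if every read-out is skew-adjoint on the real subgroup `𝓡𝒴`, so is every twisted read-out
(`(zXz⋆)⋆ = −zXz⋆`, Mathlib `skewAdjoint.conjugate`; no unitarity needed). [folklore] -/
theorem twistRO_skew (𝓡𝒴 : AddSubgroup 𝒴) : ∀ (qs : List (Matrix n n ℂ × (𝒴 →L[ℂ] Matrix n n ℂ))) (P : Matrix n n ℂ),
    (∀ q ∈ qs, ∀ Y ∈ 𝓡𝒴, q.2 Y ∈ skewAdjoint (Matrix n n ℂ)) →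
    ∀ ℓ ∈ twistRO P qs, ∀ Y ∈ 𝓡𝒴, ℓ Y ∈ skewAdjoint (Matrix n n ℂ)
  | [], _, _, ℓ, hℓ, _, _ => by simp at hℓ
  | q :: rest, P, hq, ℓ, hℓ, Y, hY => by
    rw [twistRO_cons, List.mem_cons] at hℓ
    rcases hℓ with rfl | hℓ
    · rw [twist_apply]
      exact skewAdjoint.conjugate (hq q (by simp) Y hY) _
    · exact twistRO_skew 𝓡𝒴 rest (P * q.1) (fun q' hq' => hq q' (List.mem_cons_of_mem _ hq')) ℓ hℓ Y hY

/-- **THE LETTER SUM OF THE TWISTED LIST IS THE COVARIANT CURL** (four positions, `P = 1`; [Balaban1985Variational] (25) «the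
expression in parenthesis (…) is equal to η(DA)(p)» — LOCATOR): the ONE binder of S74 whose currency changes. [folklore] -/
theorem twistRO_sum_four (u₁ u₂ u₃ u₄ : Matrix n n ℂ) (ℓ₁ ℓ₂ ℓ₃ ℓ₄ : 𝒴 →L[ℂ] Matrix n n ℂ) (Y : 𝒴) :
    ((twistRO 1 [(u₁, ℓ₁), (u₂, ℓ₂), (u₃, ℓ₃), (u₄, ℓ₄)]).map fun ℓ => ℓ Y).sum =
      u₁ * ℓ₁ Y * star u₁ + (u₁ * u₂) * ℓ₂ Y * star (u₁ * u₂) + (u₁ * u₂ * u₃) * ℓ₃ Y * star (u₁ * u₂ * u₃) +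
        (u₁ * u₂ * u₃ * u₄) * ℓ₄ Y * star (u₁ * u₂ * u₃ * u₄) := by
  simp only [twistRO_cons, twistRO_nil, List.map_cons, List.map_nil, List.sum_cons, List.sum_nil, twist_apply, one_mul,
    add_zero]
  simp only [mul_assoc, add_assoc]

end Twist

/-! ## §3 S74 §4 re-concluded for the INTERLEAVED Wilson profile on the LD chain -/

section ChartRay

open scoped Matrix.Norms.L2Operator

variable {nM : Type*} [Fintype nM] [DecidableEq nM] [Nonempty nM]
variable {𝒴 𝒴' 𝒳 𝒵 ℬ : Type*} [NormedAddCommGroup 𝒴] [NormedSpace ℂ 𝒴] [CompleteSpace 𝒴]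
  [NormedAddCommGroup 𝒴'] [NormedSpace ℂ 𝒴'] [NormedAddCommGroup 𝒳] [NormedSpace ℂ 𝒳] [CompleteSpace 𝒳]
  [NormedAddCommGroup 𝒵] [NormedSpace ℂ 𝒵] [NormedAddCommGroup ℬ] [NormedSpace ℂ ℬ]
variable {n : ℕ} {𝒢 : 𝒵 →L[ℂ] 𝒴} {W𝒱 : 𝒴 → 𝒵} {B₀ C₄ a₃ : ℝ}

/-- **END-II's `hE` FOR THE WILSON PART ON THE LD CHAIN — INTERLEAVED PLAQUETTE WORDS AS SQUARE TERMS (flat).**  S74 §4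
`hE_landau_wilsonSquares` (chain binders VERBATIM: (P2) `h𝒢`, (P4) `hW`, (118)∕(121), (103), (75), (44), `hι`, (46), (54), the
real structure) for INTERLEAVED data: per weight plaquette `p` the (frozen factor, read-out) pairs `pairs p` and a trailing
frozen factor `uT p`; displayed: `hu`∕`huT` (UNITARY), `hBd : ‖(Π_k u_{p,k})·uT p − 1‖ ≤ d p` (background plaquette deviation,
(14)∕(19)∕(2.17) TYPE), `hℓw` (per-letter constants `κ_w p`, UNtwisted — preserved, §2), `hskew` (preserved), lengths, and
**`hcurl` ON THE TWISTED LIST** (covariant-curl read-out norm `κ_c p`, B11 (25)∕(37) TYPE — located, NOT asserted); budget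
VERBATIM.  CONCLUSION — END-II's `hE` LITERALLY for the INTERLEAVED Wilson ray profile with `B_𝓔 = 3H̄∕(r_Φ∕S − 1)` (ONE call
of S74 §4 on `Bp := (Π_k u_{p,k})·uT p`, `ℓw := twistRO 1 (pairs p)`, then `trace_interleaved_eq` pointwise). [folklore] -/
theorem hE_landau_wilsonSquares_twisted {𝔭 : Type*} {W : Set (Fin n → ℝ)} {Pw : Finset 𝔭} {S : ℝ}
    (hS : 0 < S) (hWS : W ⊆ closedBall (0 : Fin n → ℝ) S)
    (h𝒢 : ∀ f, ‖𝒢 f‖ ≤ B₀ * ‖f‖) (hW : Prop4Hyp W𝒱 C₄ a₃) (hB₀ : 0 < B₀) (hC₄ : 0 ≤ C₄)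
    {b ε₄ : ℝ} (hε₄ : 0 ≤ ε₄) (hdom : 2 * (ε₄ + B₀ * b) ≤ a₃)
    (hself : B₀ * C₄ * (ε₄ + B₀ * b) ^ 2 ≤ ε₄) (hcontr : 4 * B₀ * C₄ * (ε₄ + B₀ * b) < 1)
    (H₁ : ℬ →L[ℂ] 𝒴) (hH₁ : ∀ B, ‖H₁ B‖ ≤ B₀ * ‖B‖)
    {Φ : (Fin n → ℂ) → ℬ} {rΦ : ℝ} (hΦd : DifferentiableOn ℂ Φ (ball 0 rΦ)) (hΦ0 : Φ 0 = 0)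
    (hΦ : ∀ z ∈ ball (0 : Fin n → ℂ) rΦ, ‖Φ z‖ < b) (hSr : S < rΦ)
    {C : 𝒴' → 𝒳} {C₂ R : ℝ} (hC₂ : 0 ≤ C₂) (hCq : ∀ Z : 𝒴', ‖Z‖ < R → ‖C Z‖ ≤ C₂ * ‖Z‖ ^ 2)
    (hCd : DifferentiableOn ℂ C (ball 0 R)) (ι : 𝒴 →L[ℂ] 𝒴') (hι : ∀ Y, ‖ι Y‖ ≤ ‖Y‖) (H : 𝒳 →L[ℂ] 𝒴)
    (hH : ∀ X, ‖H X‖ ≤ B₀ * ‖X‖) (hq : 9 * C₂ * B₀ * (ε₄ + B₀ * b) < 1) (hRC : 3 * (ε₄ + B₀ * b) ≤ R)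
    -- INTERLEAVED plaquette data: per plaquette the (frozen factor, read-out) pairs and a trailing frozen factor
    (pairs : 𝔭 → List (Matrix nM nM ℂ × (𝒴 →L[ℂ] Matrix nM nM ℂ))) (uT : 𝔭 → Matrix nM nM ℂ)
    (hu : ∀ p ∈ Pw, ∀ q ∈ pairs p, q.1 ∈ unitary (Matrix nM nM ℂ)) (huT : ∀ p ∈ Pw, uT p ∈ unitary (Matrix nM nM ℂ))
    -- the background plaquette's deviation from `1` (DISPLAYED)
    {d : 𝔭 → ℝ} (hBd : ∀ p ∈ Pw, ‖((pairs p).map Prod.fst).prod * uT p - 1‖ ≤ d p)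
    -- per-letter read-out norms (UNtwisted) AND the covariant-curl read-out norm (on the TWISTED list) — DISPLAYED; lengths
    {κw κc : 𝔭 → ℝ} (hκw : ∀ p ∈ Pw, 0 ≤ κw p) (hκc : ∀ p ∈ Pw, 0 ≤ κc p)
    (hℓw : ∀ p ∈ Pw, ∀ q ∈ pairs p, ∀ Y, ‖q.2 Y‖ ≤ κw p * ‖Y‖)
    (hcurl : ∀ p ∈ Pw, ∀ Y, ‖((twistRO 1 (pairs p)).map fun ℓ => ℓ Y).sum‖ ≤ κc p * ‖Y‖)
    {mw : ℕ} (hlenw : ∀ p ∈ Pw, (pairs p).length ≤ mw)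
    -- the real structure (chain (A)) with SKEW (untwisted) read-outs (chain (E))
    (𝓡𝒴 : AddSubgroup 𝒴) (h𝓡𝒴 : IsClosed (𝓡𝒴 : Set 𝒴)) (𝓡𝒵 : AddSubgroup 𝒵) (𝓡𝒴' : AddSubgroup 𝒴')
    (𝓡𝒳 : AddSubgroup 𝒳) (h𝓡𝒳 : IsClosed (𝓡𝒳 : Set 𝒳)) (𝓡ℬ : AddSubgroup ℬ)
    (h𝒢r : ∀ f ∈ 𝓡𝒵, 𝒢 f ∈ 𝓡𝒴) (hWr : ∀ Y ∈ 𝓡𝒴, W𝒱 Y ∈ 𝓡𝒵) (hιr : ∀ Y ∈ 𝓡𝒴, ι Y ∈ 𝓡𝒴')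
    (hHr : ∀ X ∈ 𝓡𝒳, H X ∈ 𝓡𝒴) (hCr : ∀ Z ∈ 𝓡𝒴', C Z ∈ 𝓡𝒳) (hH₁r : ∀ B ∈ 𝓡ℬ, H₁ B ∈ 𝓡𝒴)
    (hΦr : ∀ y : Fin n → ℝ, ‖y‖ ≤ S → Φ (cplx y) ∈ 𝓡ℬ)
    (hskew : ∀ p ∈ Pw, ∀ q ∈ pairs p, ∀ Y ∈ 𝓡𝒴, q.2 Y ∈ skewAdjoint (Matrix nM nM ℂ))
    -- the budget, second order per plaquette (VERBATIM as in S74 §4)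
    {β Hbar : ℝ}
    (hsum : ∑ p ∈ Pw, |β| * (d p + (κc p * ((ε₄ + B₀ * b) + B₀ * (4 * C₂ * (ε₄ + B₀ * b) ^ 2)) +
        expTail₂ (mw * (κw p * ((ε₄ + B₀ * b) + B₀ * (4 * C₂ * (ε₄ + B₀ * b) ^ 2)))))) *
      (κc p * ((ε₄ + B₀ * b) + B₀ * (4 * C₂ * (ε₄ + B₀ * b) ^ 2)) +
        expTail₂ (mw * (κw p * ((ε₄ + B₀ * b) + B₀ * (4 * C₂ * (ε₄ + B₀ * b) ^ 2))))) ≤ Hbar) :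
    ∀ x ∈ W, ∀ c : ℝ, 1 / 2 ≤ c → c ≤ 1 →
      (fun y => ∑ p ∈ Pw, β * (1 - (Matrix.trace ((((pairs p).map fun q => q.1 * exp (q.2 (landauExp C ι H
        (4 * C₂ * (ε₄ + B₀ * b) ^ 2) (solAt 𝒢 0 W𝒱 ε₄ (0 : 𝒵) (H₁ (Φ (cplx y))) + H₁ (Φ (cplx y)))))).prod) *
          uT p)).re / Fintype.card nM)) (c • x) ≤
      (fun y => ∑ p ∈ Pw, β * (1 - (Matrix.trace ((((pairs p).map fun q => q.1 * exp (q.2 (landauExp C ι H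
        (4 * C₂ * (ε₄ + B₀ * b) ^ 2) (solAt 𝒢 0 W𝒱 ε₄ (0 : 𝒵) (H₁ (Φ (cplx y))) + H₁ (Φ (cplx y)))))).prod) *
          uT p)).re / Fintype.card nM)) x +
        (1 - c) * (3 * Hbar / (rΦ / S - 1)) := by
  -- S74 §4 on the twisted read-outs and the background plaquettes
  have h := hE_landau_wilsonSquares hS hWS h𝒢 hW hB₀ hC₄ hε₄ hdom hself hcontr H₁ hH₁ hΦd hΦ0 hΦ hSr hC₂ hCq hCd ι hι
    H hH hq hRC (fun p => twistRO 1 (pairs p)) (κw := κw) (κc := κc) hκw hκc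
    (fun p hp => norm_twistRO_le (pairs p) (unitary _).one_mem (hu p hp) (hℓw p hp)) hcurl
    (mw := mw) (fun p hp => by rw [twistRO_length]; exact hlenw p hp)
    𝓡𝒴 h𝓡𝒴 𝓡𝒵 𝓡𝒴' 𝓡𝒳 h𝓡𝒳 𝓡ℬ h𝒢r hWr hιr hHr hCr hH₁r hΦr
    (fun p hp => twistRO_skew 𝓡𝒴 (pairs p) 1 (hskew p hp))
    (fun p => ((pairs p).map Prod.fst).prod * uT p)
    (fun p hp => (unitary _).mul_mem (list_prod_mem fun u hu' => by
      obtain ⟨q, hq', rfl⟩ := List.mem_map.1 hu'; exact hu p hp q hq') (huT p hp)) hBd hsum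
  -- the two profiles agree pointwise: the interleaved trace IS the prefactor-times-twisted-word trace
  have key : (fun y => ∑ p ∈ Pw, β * (1 - (Matrix.trace ((((pairs p).map fun q => q.1 * exp (q.2 (landauExp C ι H
        (4 * C₂ * (ε₄ + B₀ * b) ^ 2) (solAt 𝒢 0 W𝒱 ε₄ (0 : 𝒵) (H₁ (Φ (cplx y))) + H₁ (Φ (cplx y)))))).prod) *
          uT p)).re / Fintype.card nM)) =
      (fun y => ∑ p ∈ Pw, β * (1 - (Matrix.trace ((((pairs p).map Prod.fst).prod * uT p) * holOf (twistRO 1 (pairs p))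
        (fun y => landauExp C ι H (4 * C₂ * (ε₄ + B₀ * b) ^ 2)
          (solAt 𝒢 0 W𝒱 ε₄ (0 : 𝒵) (H₁ (Φ (cplx y))) + H₁ (Φ (cplx y)))) y)).re / Fintype.card nM)) := by
    funext y
    refine Finset.sum_congr rfl fun p hp => ?_
    rw [holOf_apply, trace_interleaved_eq (pairs p) (hu p hp) (uT p)]
  rw [key]
  exact h

variable {P𝒴 P𝒴' P𝒳 Pℬ : Type*} [NormedAddCommGroup P𝒴] [NormedSpace ℂ P𝒴] [NormedAddCommGroup P𝒴']
  [NormedSpace ℂ P𝒴'] [NormedAddCommGroup P𝒳] [NormedSpace ℂ P𝒳] [NormedAddCommGroup Pℬ] [NormedSpace ℂ Pℬ]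

/-- **THE PINNED TWIN** (live-level form): S74 f2 §3 `hE_landau_wilsonSquares_pinned` re-concluded for INTERLEAVED data —
its binders VERBATIM (flat chain; reading `π𝒴 π𝒴′ π𝒳 πℬ` with leaf-07's pinned chain binders; PINNED per-letter bounds
`‖ℓ_{p,k} Y‖ ≤ κ_w p·‖π𝒴 Y‖` on the UNtwisted read-outs, preserved by §2; `hskew`; lengths; budget in `z_pin`) except
`hu`∕`huT`∕`hBd` and **`hcurlπ` ON THE TWISTED LIST** (pinned covariant-curl read-out norm).  CONCLUSION: END-II's `hE` for the
INTERLEAVED Wilson ray profile, `B_𝓔 = 3H̄∕(r_Φ∕S − 1)`. [folklore] -/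
theorem hE_landau_wilsonSquares_pinned_twisted {𝔭 : Type*} {W : Set (Fin n → ℝ)} {Pw : Finset 𝔭} {S : ℝ}
    (hS : 0 < S) (hWS : W ⊆ closedBall (0 : Fin n → ℝ) S)
    (h𝒢 : ∀ f, ‖𝒢 f‖ ≤ B₀ * ‖f‖) (hW : Prop4Hyp W𝒱 C₄ a₃) (hB₀ : 0 < B₀) (hC₄ : 0 ≤ C₄)
    {b ε₄ : ℝ} (hε₄ : 0 ≤ ε₄) (hdom : 2 * (ε₄ + B₀ * b) ≤ a₃)
    (hself : B₀ * C₄ * (ε₄ + B₀ * b) ^ 2 ≤ ε₄) (hcontr : 4 * B₀ * C₄ * (ε₄ + B₀ * b) < 1)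
    (H₁ : ℬ →L[ℂ] 𝒴) (hH₁ : ∀ B, ‖H₁ B‖ ≤ B₀ * ‖B‖)
    {Φ : (Fin n → ℂ) → ℬ} {rΦ : ℝ} (hΦd : DifferentiableOn ℂ Φ (ball 0 rΦ)) (hΦ0 : Φ 0 = 0)
    (hΦ : ∀ z ∈ ball (0 : Fin n → ℂ) rΦ, ‖Φ z‖ < b) (hSr : S < rΦ)
    {C : 𝒴' → 𝒳} {C₂ R : ℝ} (hC₂ : 0 ≤ C₂) (hCq : ∀ Z : 𝒴', ‖Z‖ < R → ‖C Z‖ ≤ C₂ * ‖Z‖ ^ 2)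
    (hCd : DifferentiableOn ℂ C (ball 0 R)) (ι : 𝒴 →L[ℂ] 𝒴') (hι : ∀ Y, ‖ι Y‖ ≤ ‖Y‖) (H : 𝒳 →L[ℂ] 𝒴)
    (hH : ∀ X, ‖H X‖ ≤ B₀ * ‖X‖) (hq : 9 * C₂ * B₀ * (ε₄ + B₀ * b) < 1) (hRC : 3 * (ε₄ + B₀ * b) ≤ R)
    -- the reading and leaf-07's pinned chain binders (DISPLAYED) — VERBATIM as in S74 f2 §3
    (π𝒴 : 𝒴 →L[ℂ] P𝒴) (π𝒴' : 𝒴' →L[ℂ] P𝒴') (π𝒳 : 𝒳 →L[ℂ] P𝒳) (πℬ : ℬ →L[ℂ] Pℬ) {qW LC cι BH B₁p bp : ℝ}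
    (hGWp : ∀ Y Y', ‖Y‖ < ε₄ + B₀ * b → ‖Y'‖ < ε₄ + B₀ * b →
      ‖π𝒴 (𝒢 (W𝒱 Y)) - π𝒴 (𝒢 (W𝒱 Y'))‖ ≤ qW * ‖π𝒴 Y - π𝒴 Y'‖) (hqW : qW < 1)
    (hCp : ∀ A A' : 𝒴', ‖A‖ < R → ‖A'‖ < R → ‖π𝒳 (C A) - π𝒳 (C A')‖ ≤ LC * ‖π𝒴' A - π𝒴' A'‖)
    (hιp : ∀ Y, ‖π𝒴' (ι Y)‖ ≤ cι * ‖π𝒴 Y‖) (hHp : ∀ X, ‖π𝒴 (H X)‖ ≤ BH * ‖π𝒳 X‖)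
    (hLC : 0 ≤ LC) (hcι : 0 ≤ cι) (hBH : 0 ≤ BH) (hk : LC * cι * BH < 1)
    (hB₁p : 0 ≤ B₁p) (hH₁p : ∀ B, ‖π𝒴 (H₁ B)‖ ≤ B₁p * ‖πℬ B‖)
    (hΦp : ∀ z ∈ ball (0 : Fin n → ℂ) rΦ, ‖πℬ (Φ z)‖ ≤ bp) (hbp : 0 ≤ bp)
    -- INTERLEAVED plaquette data
    (pairs : 𝔭 → List (Matrix nM nM ℂ × (𝒴 →L[ℂ] Matrix nM nM ℂ))) (uT : 𝔭 → Matrix nM nM ℂ)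
    (hu : ∀ p ∈ Pw, ∀ q ∈ pairs p, q.1 ∈ unitary (Matrix nM nM ℂ)) (huT : ∀ p ∈ Pw, uT p ∈ unitary (Matrix nM nM ℂ))
    {d : 𝔭 → ℝ} (hBd : ∀ p ∈ Pw, ‖((pairs p).map Prod.fst).prod * uT p - 1‖ ≤ d p)
    -- PINNED per-letter read-out norms (UNtwisted) AND the pinned covariant-curl read-out norm (TWISTED list); lengths
    {κw κc : 𝔭 → ℝ} (hκw : ∀ p ∈ Pw, 0 ≤ κw p) (hκc : ∀ p ∈ Pw, 0 ≤ κc p)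
    (hℓwπ : ∀ p ∈ Pw, ∀ q ∈ pairs p, ∀ Y, ‖q.2 Y‖ ≤ κw p * ‖π𝒴 Y‖)
    (hcurlπ : ∀ p ∈ Pw, ∀ Y, ‖((twistRO 1 (pairs p)).map fun ℓ => ℓ Y).sum‖ ≤ κc p * ‖π𝒴 Y‖)
    {mw : ℕ} (hlenw : ∀ p ∈ Pw, (pairs p).length ≤ mw)
    -- the real structure with SKEW (untwisted) read-outs
    (𝓡𝒴 : AddSubgroup 𝒴) (h𝓡𝒴 : IsClosed (𝓡𝒴 : Set 𝒴)) (𝓡𝒵 : AddSubgroup 𝒵) (𝓡𝒴' : AddSubgroup 𝒴')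
    (𝓡𝒳 : AddSubgroup 𝒳) (h𝓡𝒳 : IsClosed (𝓡𝒳 : Set 𝒳)) (𝓡ℬ : AddSubgroup ℬ)
    (h𝒢r : ∀ f ∈ 𝓡𝒵, 𝒢 f ∈ 𝓡𝒴) (hWr : ∀ Y ∈ 𝓡𝒴, W𝒱 Y ∈ 𝓡𝒵) (hιr : ∀ Y ∈ 𝓡𝒴, ι Y ∈ 𝓡𝒴')
    (hHr : ∀ X ∈ 𝓡𝒳, H X ∈ 𝓡𝒴) (hCr : ∀ Z ∈ 𝓡𝒴', C Z ∈ 𝓡𝒳) (hH₁r : ∀ B ∈ 𝓡ℬ, H₁ B ∈ 𝓡𝒴)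
    (hΦr : ∀ y : Fin n → ℝ, ‖y‖ ≤ S → Φ (cplx y) ∈ 𝓡ℬ)
    (hskew : ∀ p ∈ Pw, ∀ q ∈ pairs p, ∀ Y ∈ 𝓡𝒴, q.2 Y ∈ skewAdjoint (Matrix nM nM ℂ))
    -- the budget in `z_pin` (VERBATIM as in S74 f2 §3)
    {β Hbar : ℝ}
    (hsum : ∑ p ∈ Pw, |β| * (d p + (κc p * (B₁p * bp / ((1 - qW) * (1 - LC * cι * BH))) +
        expTail₂ (mw * (κw p * (B₁p * bp / ((1 - qW) * (1 - LC * cι * BH))))))) *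
      (κc p * (B₁p * bp / ((1 - qW) * (1 - LC * cι * BH))) +
        expTail₂ (mw * (κw p * (B₁p * bp / ((1 - qW) * (1 - LC * cι * BH)))))) ≤ Hbar) :
    ∀ x ∈ W, ∀ c : ℝ, 1 / 2 ≤ c → c ≤ 1 →
      (fun y => ∑ p ∈ Pw, β * (1 - (Matrix.trace ((((pairs p).map fun q => q.1 * exp (q.2 (landauExp C ι H
        (4 * C₂ * (ε₄ + B₀ * b) ^ 2) (solAt 𝒢 0 W𝒱 ε₄ (0 : 𝒵) (H₁ (Φ (cplx y))) + H₁ (Φ (cplx y)))))).prod) *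
          uT p)).re / Fintype.card nM)) (c • x) ≤
      (fun y => ∑ p ∈ Pw, β * (1 - (Matrix.trace ((((pairs p).map fun q => q.1 * exp (q.2 (landauExp C ι H
        (4 * C₂ * (ε₄ + B₀ * b) ^ 2) (solAt 𝒢 0 W𝒱 ε₄ (0 : 𝒵) (H₁ (Φ (cplx y))) + H₁ (Φ (cplx y)))))).prod) *
          uT p)).re / Fintype.card nM)) x +
        (1 - c) * (3 * Hbar / (rΦ / S - 1)) := by
  -- S74 f2 §3 on the twisted read-outs and the background plaquettes
  have h := hE_landau_wilsonSquares_pinned hS hWS h𝒢 hW hB₀ hC₄ hε₄ hdom hself hcontr H₁ hH₁ hΦd hΦ0 hΦ hSr hC₂ hCq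
    hCd ι hι H hH hq hRC π𝒴 π𝒴' π𝒳 πℬ hGWp hqW hCp hιp hHp hLC hcι hBH hk hB₁p hH₁p hΦp hbp
    (fun p => twistRO 1 (pairs p)) (κw := κw) (κc := κc) hκw hκc
    (fun p hp => norm_twistRO_le (pairs p) (unitary _).one_mem (hu p hp) (hℓwπ p hp)) hcurlπ
    (mw := mw) (fun p hp => by rw [twistRO_length]; exact hlenw p hp)
    𝓡𝒴 h𝓡𝒴 𝓡𝒵 𝓡𝒴' 𝓡𝒳 h𝓡𝒳 𝓡ℬ h𝒢r hWr hιr hHr hCr hH₁r hΦr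
    (fun p hp => twistRO_skew 𝓡𝒴 (pairs p) 1 (hskew p hp))
    (fun p => ((pairs p).map Prod.fst).prod * uT p)
    (fun p hp => (unitary _).mul_mem (list_prod_mem fun u hu' => by
      obtain ⟨q, hq', rfl⟩ := List.mem_map.1 hu'; exact hu p hp q hq') (huT p hp)) hBd hsum
  have key : (fun y => ∑ p ∈ Pw, β * (1 - (Matrix.trace ((((pairs p).map fun q => q.1 * exp (q.2 (landauExp C ι H
        (4 * C₂ * (ε₄ + B₀ * b) ^ 2) (solAt 𝒢 0 W𝒱 ε₄ (0 : 𝒵) (H₁ (Φ (cplx y))) + H₁ (Φ (cplx y)))))).prod) *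
          uT p)).re / Fintype.card nM)) =
      (fun y => ∑ p ∈ Pw, β * (1 - (Matrix.trace ((((pairs p).map Prod.fst).prod * uT p) * holOf (twistRO 1 (pairs p))
        (fun y => landauExp C ι H (4 * C₂ * (ε₄ + B₀ * b) ^ 2)
          (solAt 𝒢 0 W𝒱 ε₄ (0 : 𝒵) (H₁ (Φ (cplx y))) + H₁ (Φ (cplx y)))) y)).re / Fintype.card nM)) := by
    funext y
    refine Finset.sum_congr rfl fun p hp => ?_
    rw [holOf_apply, trace_interleaved_eq (pairs p) (hu p hp) (uT p)]
  rw [key]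
  exact h

end ChartRay


end Summit.QuantumFields.BalabanUV.T4Continuum.ShellMeasureLandauWilsonSquaresTwisted

end
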